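import Summits.ValiantsHypothesis.ValiantsHypothesis.Theorems.PolyaContinuedSignedCoverLittleReduction
import Literature.Combinatorics.SimpleGraph.MatchingMinorCentral
import HarnessLib

/-!
# Route PolyaContinued — support item `SignedCoverLittle` (stmt-ValiantsHypothesis-7426):
# transposing the target of a label identity

E-side lemma (SC1, spec `hT` of the lead's driver `…SignedCoverLittleChain.lean` for `stub_chain`
of the line `even_induction`): the label identity `Σ_{σ ∈ PM(H)} Π_i X (φ (i, σ i)) = PM_E` for a
target `E` yields the label identity for the TRANSPOSED target `transposeEdges E` (rows and
columns exchanged) with the SAME source `H` and the relabelling `Prod.swap ∘ φ` — apply the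
variable renaming `x_(i,j) ↦ x_(j,i)` to both sides; the perfect matchings of the transpose are the
inverses `π⁻¹`. This lets the driver treat a column of degree two as a row of degree two.

* `rename_swap_perfectMatchingPoly` — `rename Prod.swap (PM_E) = PM_{transposeEdges E}`;
* `labelIdentity_transpose` (and the `Function.comp`-free form `labelIdentity_transpose'`).
-/

noncomputable section

namespace Summit.ValiantsHypothesis.PolyaContinued

open MvPolynomial Finset Literature.Combinatorics.SimpleGraph Equiv

variable {n : ℕ}

/-- **Transposing the variables transposes the graph**: `x_(i,j) ↦ x_(j,i)` maps the
perfect-matching polynomial of `E` to that of `transposeEdges E` (the matching `π` of `E` becomes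
the matching `π⁻¹` of the transpose). [folklore] -/
theorem rename_swap_perfectMatchingPoly (E : Finset (Fin n × Fin n)) :
    rename Prod.swap (perfectMatchingPoly E ℂ) = perfectMatchingPoly (transposeEdges E) ℂ := by
  classical
  rw [perfectMatchingPoly_eq_sum_ite, perfectMatchingPoly_eq_sum_ite, map_sum]
  -- reindex the matchings by inversion
  refine Fintype.sum_equiv (Equiv.inv (Perm (Fin n))) _ _ fun π => ?_
  have hmem : (∀ i, (i, π i) ∈ E) ↔ ∀ j, (j, π⁻¹ j) ∈ transposeEdges E := by
    constructor
    · intro h j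
      rw [mem_transposeEdges_iff]
      simpa using h (π⁻¹ j)
    · intro h i
      have := h (π i)
      rw [mem_transposeEdges_iff] at this
      simpa using this
  simp only [Equiv.inv_apply]
  by_cases hπ : ∀ i, (i, π i) ∈ E
  · rw [if_pos hπ, if_pos (hmem.1 hπ), map_prod]
    simp only [rename_X, Prod.swap_prod_mk]
    -- `Π_i X (π i, i) = Π_j X (j, π⁻¹ j)`
    exact Fintype.prod_equiv π _ _ fun i => by simp
  · rw [if_neg hπ, if_neg fun h => hπ (hmem.2 h), map_zero]

/-- **Transposing the target of a label identity** (spec `hT` of the chain driver): from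
`Σ_{σ ⊆ H} Π_i X (φ (i, σ i)) = PM_E` to the same identity for the target `transposeEdges E` and
the relabelling `Prod.swap ∘ φ`, the source `H` unchanged. [folklore] -/
theorem labelIdentity_transpose {H E : Finset (Fin n × Fin n)} {φ : Fin n × Fin n → Fin n × Fin n}
    (hid : (∑ σ : Equiv.Perm (Fin n), if (∀ i, (i, σ i) ∈ H) then
        ∏ i, (X (φ (i, σ i)) : MvPolynomial (Fin n × Fin n) ℂ) else 0) =
      perfectMatchingPoly E ℂ) :
    (∑ σ : Equiv.Perm (Fin n), if (∀ i, (i, σ i) ∈ H) then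
        ∏ i, (X ((Prod.swap ∘ φ) (i, σ i)) : MvPolynomial (Fin n × Fin n) ℂ) else 0) =
      perfectMatchingPoly (transposeEdges E) ℂ := by
  classical
  have h := congrArg (rename Prod.swap) hid
  rw [rename_swap_perfectMatchingPoly, map_sum] at h
  rw [← h]
  refine Finset.sum_congr rfl fun σ _ => ?_
  split_ifs
  · rw [map_prod]
    exact Finset.prod_congr rfl fun i _ => by rw [rename_X, Function.comp_apply]
  · rw [map_zero]

/-- The same with `Prod.swap (φ (i, σ i))` written out. [folklore] -/
theorem labelIdentity_transpose' {H E : Finset (Fin n × Fin n)} {φ : Fin n × Fin n → Fin n × Fin n}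
    (hid : (∑ σ : Equiv.Perm (Fin n), if (∀ i, (i, σ i) ∈ H) then
        ∏ i, (X (φ (i, σ i)) : MvPolynomial (Fin n × Fin n) ℂ) else 0) =
      perfectMatchingPoly E ℂ) :
    (∑ σ : Equiv.Perm (Fin n), if (∀ i, (i, σ i) ∈ H) then
        ∏ i, (X (Prod.swap (φ (i, σ i))) : MvPolynomial (Fin n × Fin n) ℂ) else 0) =
      perfectMatchingPoly (transposeEdges E) ℂ :=
  labelIdentity_transpose hid

end Summit.ValiantsHypothesis.PolyaContinued
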